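import Mathlib.MeasureTheory.Integral.IntervalIntegral.Basic
import Mathlib.Analysis.SpecialFunctions.Pow.Real
import Mathlib.Analysis.SpecialFunctions.Trigonometric.Arctan
import Literature.NumberTheory.LFunctions.RiemannXi
import Literature.NumberTheory.LFunctions.RiemannXiProofs
import HarnessLib

/-!
# The integral of Riemann's `ξ` (Lagarias–Montague 2011) — definition and named facts

Trunk T-ANT (Literature/NumberTheory/LFunctions). Lagarias and Montague study the entire function
`ξ^{(-1)}(s) := ∫_{1/2}^{s} ξ(w) dw` [LagariasMontague2011, eq. (1.3)], its rescaling
`Ξ^{(-1)}(z) := −i ξ^{(-1)}(½ + iz)` (real on the real axis, odd) and the size of `ξ` far from and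
near the critical line. This file vendors, for the route
`Summits/RiemannHypothesis/RiemannHypothesis/Theses/NodalHairpin.lean` (whose statements INLINE the
segment integral below; `xiPrimitive_def` is `rfl`):

* `xiPrimitive s = (∫₀¹ ξ(½ + u (s − ½)) du) · (s − ½)` — the segment realisation of `ξ^{(-1)}`
  (`ξ` is entire, so the path is immaterial; the segment form is the one the route uses).
* `xiPrimitive_one_sub : xiPrimitive (1 − s) = −xiPrimitive s` — PROVED, the functional equation
  [LagariasMontague2011, eq. (1.4)] (from `ξ(1 − s) = ξ(s)`).
* `xiPrimitive_conj : xiPrimitive (conj s) = conj (xiPrimitive s)` — PROVED (Schwarz reflection of `ξ`).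
* `lmPhiZero = Φ(0) = Σ_{n ≥ 1} (4π²n⁴ − 6πn²) e^{−πn²} ≈ 0.89339` and `lmA0 = A₀ = π Φ(0) ≈ 2.80668`
  [LagariasMontague2011, Thm. 2.1 (1) and Lemma 3.1].
* NAMED FACT `LagariasMontague2011_thm21_limit` [Thm. 2.1 (1), λ = 0, in the `s`-variable as printed on
  p. 148: "`lim_{t → ±∞} ξ^{(-1)}(½ + it) = ± iA₀`"]: `ξ^{(-1)}(½ + it) → iA₀` as `t → +∞`.
* NAMED FACT `Wintner1947_im_xiPrimitive_pos` [Thm. 2.1 (2) for `λ = 0`, credited there to Wintner 1947: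
  "`Ξ₀^{(-1)}(t) > 0` when `t > 0`"]: `Im ξ^{(-1)}(½ + it) > 0` for `t > 0` (so `s = ½` is the only zero of
  `ξ^{(-1)}` on the critical line).
* NAMED FACT `LagariasMontague2011_lemma33_1` [Lemma 3.3 (1)]: for `½ ≤ Re s ≤ 2`,
  `|ξ(s)| ≤ C₁ e^{−π|t|/4} (|t| + 1)^{5/2}` — the uniform decay of `ξ` in the closed critical half-strip.
* `LagariasMontague.F σ t = √π (2πe)^{−σ/2} (σ² + t²)^{(σ+3)/4} exp(−(t/2) arctan(t/σ))` [eq. (3.7)] and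
  NAMED FACT `LagariasMontague2011_lemma33_2` [Lemma 3.3 (2)]: for `σ ≥ 2` and all real `t`,
  `F(σ,t)(1 − C₂(1/|σ+it| + 2^{−σ})) ≤ |ξ(σ+it)| ≤ F(σ,t)(1 + C₃(1/|σ+it| + 2^{−σ}))` (uniform Stirling).

Deliberately NOT here: Thm. 2.1 for `λ ≠ 0` (the de Bruijn–Newman-type family `Ξ_λ^{(-1)}`), Thm. 2.2
(value distribution `|σ| = (π/2)|t|/log|t| + O(|t|/log²|t|)` of the `a`-points of `ξ^{(-1)}`), Lemma 3.3 (3)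
(variation of `arg ξ` on `[σ₀, σ₀ + 2]`), and the derivative `(ξ^{(-1)})′ = ξ` [Lemma 3.2 (3)], which is
the route item `NodalPrimitive` (a prover's job; Mathlib: `Differentiable.isExactOn_univ`,
`intervalIntegral.integral_hasDerivAt_right`). Nothing unproved is asserted; users take `(h : <FactName>)`.

## References

* J. C. Lagarias, D. Montague, *The integral of the Riemann ξ-function*, Comment. Math. Univ. St. Pauli
  60 (2011), 143–169; arXiv:1106.4348 — §1 eqs. (1.3)–(1.4), Thm. 2.1, Lemma 3.1, Lemma 3.3. [LagariasMontague2011]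
* A. Wintner, *On an oscillatory property of the Riemann Ξ-function*, Math. Notae 7 (1947), 177–178
  (as cited in [LagariasMontague2011, §2.1]).
-/

noncomputable section

open Complex Filter Topology Set MeasureTheory
open scoped ComplexConjugate Real

namespace Literature.NumberTheory.LFunctions

/-! ## The segment primitive `ξ^{(-1)}` -/

/-- **Lagarias–Montague's integral of `ξ`**, `ξ^{(-1)}(s) := ∫_{1/2}^{s} ξ(w) dw`
[LagariasMontague2011, eq. (1.3)], realised along the segment from `½` to `s`:
`ξ^{(-1)}(s) = (∫₀¹ ξ(½ + u (s − ½)) du) · (s − ½)`. This is literally the term inlined by every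
statement of the route `…/Theses/NodalHairpin.lean` (`F(w)`; `H = Re F`). [cite: LagariasMontague2011, eq. (1.3)] -/
def xiPrimitive (s : ℂ) : ℂ :=
  (∫ u in (0:ℝ)..1, riemannXi (1 / 2 + (u : ℂ) * (s - 1 / 2))) * (s - 1 / 2)

/-- Unfolding lemma (by `rfl`): the route's inlined segment integral is `xiPrimitive`. [folklore] -/
theorem xiPrimitive_def (s : ℂ) :
    xiPrimitive s = (∫ u in (0:ℝ)..1, riemannXi (1 / 2 + (u : ℂ) * (s - 1 / 2))) * (s - 1 / 2) :=
  rfl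

/-- `ξ^{(-1)}(½) = 0`. [folklore] -/
theorem xiPrimitive_one_half : xiPrimitive (1 / 2) = 0 := by
  simp [xiPrimitive]

/-- **Functional equation** `ξ^{(-1)}(1 − s) = −ξ^{(-1)}(s)` [LagariasMontague2011, eq. (1.4)], from
`ξ(1 − w) = ξ(w)` applied pointwise under the segment integral. [cite: LagariasMontague2011, eq. (1.4)] -/
theorem xiPrimitive_one_sub (s : ℂ) : xiPrimitive (1 - s) = -xiPrimitive s := by
  unfold xiPrimitive
  have h : ∀ u : ℝ, riemannXi (1 / 2 + (u : ℂ) * ((1 - s) - 1 / 2)) =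
      riemannXi (1 / 2 + (u : ℂ) * (s - 1 / 2)) := by
    intro u
    rw [← riemannXi_one_sub (1 / 2 + (u : ℂ) * (s - 1 / 2))]
    congr 1
    ring
  simp_rw [h]
  ring

/-- **Reflection** `ξ^{(-1)}(s̄) = conj ξ^{(-1)}(s)`, from Schwarz reflection `ξ(w̄) = conj ξ(w)`
(`riemannXi_conj_holds`) under the segment integral. [folklore] -/
theorem xiPrimitive_conj (s : ℂ) : xiPrimitive (conj s) = conj (xiPrimitive s) := by
  unfold xiPrimitive
  have h : ∀ u : ℝ, riemannXi (1 / 2 + (u : ℂ) * (conj s - 1 / 2)) =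
      conj (riemannXi (1 / 2 + (u : ℂ) * (s - 1 / 2))) := by
    intro u
    rw [← riemannXi_conj_holds]
    congr 1
    simp [map_ofNat]
  simp_rw [h]
  rw [intervalIntegral.integral_of_le zero_le_one, intervalIntegral.integral_of_le zero_le_one,
    integral_conj, map_mul]
  simp [map_ofNat]

/-- Hence `ξ^{(-1)}(1 − s̄) = −conj ξ^{(-1)}(s)`: `Re ξ^{(-1)}` is odd under reflection in the critical
line (the route's `NodalOddSymmetry`, with `xiPrimitive` unfolded). [folklore] -/
theorem xiPrimitive_one_sub_conj (s : ℂ) : xiPrimitive (1 - conj s) = -conj (xiPrimitive s) := by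
  rw [xiPrimitive_one_sub, xiPrimitive_conj]

/-- In particular `Re ξ^{(-1)}(½ + it) = 0` on the critical line. [folklore] -/
theorem re_xiPrimitive_critical_line (t : ℝ) : (xiPrimitive (1 / 2 + t * I)).re = 0 := by
  have h := xiPrimitive_one_sub_conj (1 / 2 + t * I)
  have e : 1 - conj ((1 : ℂ) / 2 + t * I) = 1 / 2 + t * I := by
    apply Complex.ext <;> norm_num
  rw [e] at h
  have := congrArg Complex.re h
  simp only [neg_re, conj_re] at this
  linarith

/-! ## The constants `Φ(0)` and `A₀` -/

/-- `Φ(0) = Σ_{n ≥ 1} (4π²n⁴ − 6πn²) e^{−πn²} ≈ 0.89339`, the value at `u = 0` of the kernel `Φ` of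
Riemann's cosine-integral representation `Ξ(z) = 2 ∫₀^∞ Φ(u) cos(zu) du`
[LagariasMontague2011, Lemma 3.1, eq. (3.2) and proof of (5)]. (Indexed by `n + 1`, `n : ℕ`.) [cite: LagariasMontague2011, Lemma 3.1] -/
def lmPhiZero : ℝ :=
  ∑' n : ℕ, (4 * π ^ 2 * ((n : ℝ) + 1) ^ 4 - 6 * π * ((n : ℝ) + 1) ^ 2) * Real.exp (-π * ((n : ℝ) + 1) ^ 2)

/-- `A₀ := π Φ(0) ≈ 2.80668`, the limit of `Ξ_λ^{(-1)}(t)` as `t → ∞`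
[LagariasMontague2011, Thm. 2.1 (1), eq. (2.2)]. [cite: LagariasMontague2011, Thm. 2.1] -/
def lmA0 : ℝ := π * lmPhiZero

/-! ## Named facts -/

/-- NAMED FACT (**Lagarias–Montague 2011, Thm. 2.1 (1)** for `λ = 0`, in the `s`-variable as printed
on p. 148: "Theorem 2.1 gives two exceptional limiting values `lim_{t → ±∞} ξ^{(-1)}(½ + it) = ± iA₀`",
`A₀ = π Φ(0)`; the proof gives `Ξ^{(-1)}(t) = A₀ + O(t^{−2/3})` for `t ≥ 3`). We record the `t → +∞`
limit; the `t → −∞` one follows from `xiPrimitive_conj`. In particular `ξ^{(-1)}` is BOUNDED on the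
critical line (the input of Phragmén–Lindelöf arguments in vertical half-strips). Grounds the
boundedness/no-escape inputs of `Summit.RiemannHypothesis.RiemannHypothesis.Theses.NodalHairpin.NodalProper`.
[cite: LagariasMontague2011, Thm. 2.1] -/
def LagariasMontague2011_thm21_limit : Prop :=
  Tendsto (fun t : ℝ => xiPrimitive (1 / 2 + t * I)) atTop (𝓝 ((lmA0 : ℂ) * I))

/-- NAMED FACT (**Wintner 1947**, as recorded in Lagarias–Montague 2011, Thm. 2.1 (2) and §2.1: "In 1947
Wintner [Wi47] proved that `Ξ₀^{(-1)}(t) > 0` when `t > 0`; this fact together with the functional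
equation (1.4) implies that `ξ^{(-1)}(s)` has no zeros on the critical line except for a zero at
`s = ½`"), with `Ξ^{(-1)}(t) = −i ξ^{(-1)}(½ + it)` real for real `t` [Lemma 3.2 (2)]:
`Im ξ^{(-1)}(½ + it) > 0` for `t > 0`. [cite: LagariasMontague2011, Thm. 2.1] -/
def Wintner1947_im_xiPrimitive_pos : Prop :=
  ∀ t : ℝ, 0 < t → 0 < (xiPrimitive (1 / 2 + t * I)).im

/-- NAMED FACT (**Lagarias–Montague 2011, Lemma 3.3 (1)**): "There are positive constants `C₁, C₂, C₃`
with the following properties. (1) For `½ ≤ Re(s) ≤ 2`, the function `ξ(s)` satisfies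
`|ξ(s)| ≤ C₁ e^{−π|t|/4} (|t| + 1)^{5/2}`." (Proof: `|Γ(s/2)| = O(e^{−π|t|/4})`, `|½ s(s−1)| = O(|t|²)`,
convexity `|ζ(s)| ≤ C|t|^{1/2}` for `σ ≥ ½`, `|t| ≥ 2`.) This is the uniform decay of `ξ` at vertical
infinity in the half-strip that makes `H = Re ξ^{(-1)}` tend to `0` there; grounds
`Summit.RiemannHypothesis.RiemannHypothesis.Theses.NodalHairpin.NodalDecay` (for strips `Re s ≤ 2`;
wider strips via (2) below). [cite: LagariasMontague2011, Lemma 3.3] -/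
def LagariasMontague2011_lemma33_1 : Prop :=
  ∃ C₁ : ℝ, 0 < C₁ ∧ ∀ s : ℂ, 1 / 2 ≤ s.re → s.re ≤ 2 →
    ‖riemannXi s‖ ≤ C₁ * Real.exp (-(π / 4) * |s.im|) * (|s.im| + 1) ^ (5 / 2 : ℝ)

/-- Lagarias–Montague's comparison function [LagariasMontague2011, eq. (3.7)]:
`F(σ, t) := √π (2πe)^{−σ/2} (σ² + t²)^{(σ+3)/4} exp(−(t/2) arctan(t/σ))` (printed "for `σ ≥ 0`, `t > 0`";
the formula is even in `t` and we use it for all real `t`, as Lemma 3.3 (2) does). [cite: LagariasMontague2011, eq. (3.7)] -/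
def LagariasMontague.F (σ t : ℝ) : ℝ :=
  Real.sqrt π * (2 * π * Real.exp 1) ^ (-σ / 2) * (σ ^ 2 + t ^ 2) ^ ((σ + 3) / 4) *
    Real.exp (-(t / 2) * Real.arctan (t / σ))

/-- NAMED FACT (**Lagarias–Montague 2011, Lemma 3.3 (2)**, uniform Stirling for `ξ`): "(2) For
`s = σ + it` with `σ ≥ 2` and all real `t`, there holds
`F(σ,t)(1 − C₂(1/|σ+it| + 2^{−σ})) ≤ |ξ(s)| ≤ F(σ,t)(1 + C₃(1/|σ+it| + 2^{−σ}))`, with `F(σ,t)` given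
by (3.7)." Grounds the far-field size input (`|ξ| ≍ F(σ,t)` uniformly in `t`) of
`Summit.RiemannHypothesis.RiemannHypothesis.Theses.NodalHairpin.NodalLadderFar`. [cite: LagariasMontague2011, Lemma 3.3] -/
def LagariasMontague2011_lemma33_2 : Prop :=
  ∃ C₂ C₃ : ℝ, 0 < C₂ ∧ 0 < C₃ ∧ ∀ σ t : ℝ, 2 ≤ σ →
    LagariasMontague.F σ t * (1 - C₂ * (1 / ‖(σ : ℂ) + t * I‖ + (2 : ℝ) ^ (-σ))) ≤
        ‖riemannXi (σ + t * I)‖ ∧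
      ‖riemannXi (σ + t * I)‖ ≤
        LagariasMontague.F σ t * (1 + C₃ * (1 / ‖(σ : ℂ) + t * I‖ + (2 : ℝ) ^ (-σ)))

end Literature.NumberTheory.LFunctions
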